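import Summits.SmoothPoincare4.SmoothPoincare4.Theses.ConvexBisection
import Literature.Topology.FourManifolds.CerfGammaFourProofs
import Literature.Topology.FourManifolds.HomotopyS4CompactProofs
import HarnessLib

/-!
# Line `minimal-factorisation-rigidity` for crux `ConvexBisection.AcyclicBisectionRigidity`
(item stmt-SmoothPoincare4-10507, route `route-SmoothPoincare4-ConvexBisection`, rank 2)

Skeleton (crux-plan, planner-cruxplan-stmt-SmoothPoincare4-10507-minimal-factorisatio-0, 2026-08-15) of
the card `Cruxes/AcyclicBisectionRigidity/Ideas/minimal-factorisation-rigidity.md` ("ℚ-acyclic means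
shortest"), reshaped by the three triage notes (TRIAGE-r1-1/2/3, all `pass`): the card's seam-symmetry
step T3 (`X_F ∪_ĉ X̄_F ≅ D(X_F)`) is FALSE on the standard `S³/Q₈` bisection of `S⁴` (Disproof §5b), so the
residual is T3′ — SIMPLY CONNECTED twisted doubles `X ∪_ĉ X̄` of ONE ℚ-acyclic Stein body by a seam
contactomorphism are `S⁴` — split here into its two census sectors (Disproof §4 / §5).

THE CRUX. For every Hausdorff second-countable `C^∞` 4-manifold `M ≃ₕ S⁴`: if `M = e₁(W₁) ∪ e₂(W₂)` for two
smoothly embedded compact Stein domains meeting exactly along the images of their boundaries, with the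
complex tangencies `ξᵢ = contactPlane Jᵢ.J` pushed forward to the same plane field on the seam, and both
halves ℚ-acyclic in positive degrees, then `M ≅ S⁴`.

THE LINE (three stubs; composition `AcyclicBisectionRigidity_of`, kernel-checked, no `sorry` of its own).
* `stub_minimalFactorisationTwins` — THE LEVER (new; engine = minimal-factorisation rigidity MFR).
  Under the crux hypotheses the two halves are diffeomorphic by a `Φ : W₁ ≅ W₂` whose boundary restriction
  is a contactomorphism `(∂W₁, ξ₁) → (∂W₂, ξ₂)`. Paper proof = T1 (known modulo vendoring: Akbulut–Ozbagci /
  Loi–Piergallini turn `(Wᵢ, Jᵢ)` into positive allowable Lefschetz fibrations whose boundary open books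
  support `ξᵢ`; the common contact seam and Giroux's common positive stabilisation put BOTH halves over ONE
  open book `(S, φ)` of the seam, `Σ ≅ X_{F₊} ∪_id X̄_{F₋}` for two positive factorisations `F₊, F₋` of ONE
  monodromy; ℚ-acyclicity ⇔ each `F±` has the minimal length `rank H₁(S)` with cycles spanning `H₁(S;ℚ)`)
  + MFR (NEW, the card's T2: two minimal-length positive factorisations of `φ` whose vanishing cycles
  jointly normally generate `π₁(S)` — the trivial-`π₁`-pushout side condition, which is where `M ≃ₕ S⁴`
  enters and which excludes Wahl's two-component ℚHD smoothing pairs and all lens-space seams — are Hurwitz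
  equivalent up to global conjugation by `Aut(S, φ)`) + Kas–Matsumoto (Hurwitz-equivalent factorisations
  have isomorphic Lefschetz fibrations) + Giroux uniqueness / Gray / a collar isotopy (make `Φ|∂` an EXACT
  contactomorphism). Corollary `acyclicTwinsDiffeomorphic_of_stub` = the card's First lemma.
* `stub_contractibleTwinTwistedDouble` — RESIDUAL, CONTRACTIBLE SECTOR (= the `W₁ = W₂` slice of the
  route's rank-4 crux `ContractibleTwistedDoubleStandard`; PROVED below from it:
  `contractibleTwinTwistedDouble_of_crux4`). A homotopy 4-sphere covered by two embeddings of ONE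
  contractible Stein domain `(W, J)` meeting along the seam with matching complex tangencies (so the seam
  self-gluing `ĉ = e₂⁻¹ ∘ e₁|∂W` is a contactomorphism of `ξ_J`) is `S⁴`. Contains every presentation sphere
  `Σ(P, ε) = D(W_P)` (`ĉ` extending over `W`; Disproof §4b) and Gompf's Stein-compatible cork twists of `S⁴`.
* `stub_nonContractibleTwinTwistedDouble` — RESIDUAL, TORSION / PERFECT-π₁ SECTOR. The same with `W`
  ℚ-acyclic but NOT contractible (for a Stein 2-handlebody: `π₁ W ≠ 1`). Here `ĉ` never extends over `W`
  (`π₁ D(W) = π₁ W ≠ 1`): the sector of the INHABITED standard example `S⁴ = X_L ∪_ψ X̄_L`,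
  `X_L = N₋₂(ℝP²)`, seam `S³/Q₈` (Disproof §5b; standard by Price / Kim–Miller) and of the prism-manifold
  census (Choe–Park).
* `AcyclicBisectionRigidity_of : ConvexBisection.AcyclicBisectionRigidity` — re-parametrise the second
  half by `e₂ ∘ Φ` (tree `Manifold.IsSmoothEmbedding.comp_diffeomorph`, Mathlib `Diffeomorph.image_boundary`,
  chain rule `mfderiv_comp` + `Submodule.map_comp` for the seam planes), then case on `ContractibleSpace W₁`.

DISPROOF USED (`Cruxes/AcyclicBisectionRigidity/Disproof.lean`, cdisprove gen 2, read 2026-08-15).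
`false_without_homotopyEquiv` (H = `M ≃ₕ S⁴` is load-bearing): the line uses H twice — at
`stub_minimalFactorisationTwins` (trivial π₁-pushout = the side condition of MFR) and at both residual stubs
(simple connectivity of the twisted double); `collapse_without_acyclic` / rattack's mutation lemma
(acyclicity is the only conjunct separating the crux from SPC4): acyclicity = minimal length is the HYPOTHESIS
of MFR (non-minimal factorisations are not Hurwitz-rigid: lantern), and `stub_nonContractibleTwinTwistedDouble`
keeps it explicitly; §4 `contractibleSector_of_crux4`: our contractible stub is literally implied by crux 4
(proved here); §4b: presentation spheres sit inside `stub_contractibleTwinTwistedDouble` at `ĉ = id` — not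
claimed easy; §5b: the `S³/Q₈` bisection of `S⁴` satisfies every hypothesis of `stub_minimalFactorisationTwins`
(twins hold: `X_L = X_L`) and of `stub_nonContractibleTwinTwistedDouble` (conclusion true: Price) — this is
exactly why the card's T3 was replaced; §6: `AcyclicTwinsDiffeomorphic` (corollary below) dies iff the
Akbulut–Yildiz (arXiv:1901.00806 Thm 1) or Hayden–Mark–Piccirillo (arXiv:1908.05269 §6.0.1) exotic
contractible Stein pairs induce CONTACTOMORPHIC structures on their common boundary — the line's cheapest
falsifier, acknowledged; §8: the transport gap (`IsSmoothEmbedding ∘ Diffeomorph`) is closed by the tree lemma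
used in the composition. No Negative/ lemma has landed for this crux (checked 2026-08-15); negatives index: 0.
-/

noncomputable section

open scoped Manifold ContDiff Topology ContinuousMap
open Set Function
open Literature.Geometry.Symplectic Literature.AlgebraicTopology.SingularHomology CategoryTheory.Limits

-- The namespace is prescribed by the crux protocol (`Summit.<P>.<Sub>.Cruxes.<Crux>.<Slug>` with
-- `P = Sub = SmoothPoincare4`), hence the duplicated component.
set_option linter.dupNamespace false
set_option linter.unusedVariables false

namespace Summit.SmoothPoincare4.SmoothPoincare4.Cruxes.AcyclicBisectionRigidity.MinimalFactorisationRigidity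

open Summit.SmoothPoincare4.SmoothPoincare4.Theses

/-- Local notation: the round 4-sphere with its Mathlib manifold structure. -/
local notation "𝕊⁴" => (Metric.sphere (0 : EuclideanSpace ℝ (Fin 5)) 1)

/-- Local notation: the model space `ℝ⁴`. -/
local notation "E4" => EuclideanSpace ℝ (Fin 4)

/-! ## Stub 1 — the lever: minimal-factorisation twins -/

/-- **Stub 1 (THE LEVER, new): the two halves of an acyclic common-contact Stein bisection of a homotopy
4-sphere are CONTACT TWINS.** Under the hypotheses of the crux, unbundled (`M ≃ₕ S⁴`; `(W₁, J₁)`, `(W₂, J₂)`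
compact Stein domains; `e₁, e₂` smooth embeddings covering `M` and meeting exactly along the images of their
boundaries; pushed-forward complex tangencies equal on the seam; both halves ℚ-acyclic in positive degrees),
there is a diffeomorphism `Φ : W₁ ≅ W₂` whose differential carries `ξ₁ = contactPlane J₁.J` to
`ξ₂ = contactPlane J₂.J` at every boundary point — `Φ|∂W₁` is a contactomorphism `(∂W₁, ξ₁) → (∂W₂, ξ₂)`
(NOT required to be the seam identification `e₂⁻¹ ∘ e₁`, which need not extend: `S³/Q₈`, corks).
Why plausibly true — the minimal-factorisation mechanism: (T1, known modulo vendoring) each `(Wᵢ, Jᵢ)` is a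
positive allowable Lefschetz fibration over `D²` whose boundary open book supports `ξᵢ` (Akbulut–Ozbagci
arXiv:math/0012239 Thm 5; Loi–Piergallini 2001); transported to the seam by `e₁`, `e₂` (both orientation
preserving onto the seam oriented by `ξ`, so `Σ = W₁ ∪_ψ W̄₂`) these are two open books supporting ONE
contact structure, hence have a common positive stabilisation (Giroux 2002), over which both halves are still
PALFs: `W₁ ≅ X_{F₊}`, `W₂ ≅ X_{F₋}` for two positive factorisations `F₊, F₋` of ONE monodromy
`φ ∈ Mod(S, ∂S)`; `χ(X_F) = χ(S) + #F` and `b₁(X_F) = 0` make "ℚ-acyclic" equivalent to "length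
`#F = rank H₁(S)` and the vanishing cycles are a ℚ-basis of `H₁(S; ℚ)`" — the MINIMAL conceivable length,
preserved by stabilisation. (T2 = MFR, NEW) two such minimal factorisations whose cycles JOINTLY normally
generate `π₁(S)` (⇔ `π₁(X_{F₊} ∪ X̄_{F₋}) = 1`, from `M ≃ₕ S⁴`) are Hurwitz equivalent up to global
conjugation by `Aut(S, φ)` — the mapping-class analogue of Deligne–Bessis transitivity on reduced reflection
decompositions of a Coxeter element (arXiv:math/0101158 Prop 1.6.1) and of Gabrielov–Brieskorn transitivity
on distinguished bases (length μ = rank H₁ of the Milnor fibre); cheap cases checked by the triagers: `P₃`,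
`(P₄, boundary multitwist)` (Plamenevskaya–Van Horn-Morris arXiv:0912.1916: one class per length),
`(T₁,₁, t_a t_b)`; the side condition is what excludes Wahl's two-component ℚHD smoothing pairs
(`|K ⊓ K′| = 3p`, so `H₁` of the union ≠ 0) and every lens-space seam (`|H₁| = p²` not a product).
(Kas 1980 / Matsumoto 1996, Gompf–Stipsicz §8.2) Hurwitz moves and global conjugation give an isomorphism of
Lefschetz fibrations `X_{F₋} ≅ X_{F₊}` acting on the boundary open book by `ĉ`, `c ∈ Aut(S, φ)`; it is a
contactomorphism up to an isotopy supported by that open book (Giroux uniqueness), made EXACT by composing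
`Φ` with a collar extension of the Gray isotopy. Size XL (MFR is a new theorem of planar/surface mapping class
group combinatorics, machine-checkable for `Mod(P_k, ∂) ≅ PB_{k−1} × ℤ^{k−1}`, k ≤ 5; plus vendoring of
AO/LP, Giroux, Kas–Matsumoto as named facts). Cheapest falsifier: the corollary
`acyclicTwinsDiffeomorphic_of_stub` below dies on ONE contact ℚHS³ with two non-diffeomorphic ℚ-acyclic Stein
fillings glued to a homotopy sphere by a contactomorphism — first test: are the Stein structures of the
Akbulut–Yildiz / Hayden–Mark–Piccirillo exotic contractible pairs contactomorphic on the common boundary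
(Disproof §6)? -/
theorem stub_minimalFactorisationTwins
    (M : Type) [TopologicalSpace M] [T2Space M] [SecondCountableTopology M] [ChartedSpace E4 M]
    [IsManifold (𝓡 4) ∞ M] (hM : M ≃ₕ 𝕊⁴)
    (W₁ : Type) [TopologicalSpace W₁] [ChartedSpace (EuclideanHalfSpace 4) W₁] [IsManifold (𝓡∂ 4) ∞ W₁]
    [CompactSpace W₁] (W₂ : Type) [TopologicalSpace W₂] [ChartedSpace (EuclideanHalfSpace 4) W₂]
    [IsManifold (𝓡∂ 4) ∞ W₂] [CompactSpace W₂] (J₁ : SteinStructure W₁) (J₂ : SteinStructure W₂)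
    (e₁ : W₁ → M) (e₂ : W₂ → M)
    (he₁ : Manifold.IsSmoothEmbedding (𝓡∂ 4) (𝓡 4) ∞ e₁)
    (he₂ : Manifold.IsSmoothEmbedding (𝓡∂ 4) (𝓡 4) ∞ e₂)
    (hcover : range e₁ ∪ range e₂ = univ)
    (hseam₁ : range e₁ ∩ range e₂ = e₁ '' (𝓡∂ 4).boundary W₁)
    (hseam₂ : range e₁ ∩ range e₂ = e₂ '' (𝓡∂ 4).boundary W₂)
    (hξ : ∀ w₁ w₂, e₁ w₁ = e₂ w₂ →
      Submodule.map (mfderiv (𝓡∂ 4) (𝓡 4) e₁ w₁).toLinearMap (contactPlane J₁.J w₁) =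
      Submodule.map (mfderiv (𝓡∂ 4) (𝓡 4) e₂ w₂).toLinearMap (contactPlane J₂.J w₂))
    (hac : ∀ k, 0 < k → IsZero (singularHomology ℚ ℚ W₁ k) ∧ IsZero (singularHomology ℚ ℚ W₂ k)) :
    ∃ Φ : W₁ ≃ₘ⟮𝓡∂ 4, 𝓡∂ 4⟯ W₂, ∀ w, w ∈ (𝓡∂ 4).boundary W₁ →
      Submodule.map (mfderiv (𝓡∂ 4) (𝓡∂ 4) Φ w).toLinearMap (contactPlane J₁.J w) =
        contactPlane J₂.J (Φ w) := by
  sorry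

/-! ## Stub 2 — residual, contractible sector: contact twisted doubles of one contractible Stein body -/

/-- **Stub 2 (RESIDUAL, CONTRACTIBLE SECTOR; = crux 4 restricted to `W₁ = W₂`): a homotopy 4-sphere that is a
contact twisted double `W ∪_ĉ W̄` of ONE contractible Stein domain is `S⁴`.** Data: `M ≃ₕ S⁴`; `(W, J)` a
compact CONTRACTIBLE Stein domain; two smooth embeddings `e₁, e₂ : W → M` covering `M` and meeting exactly
along `e₁(∂W) = e₂(∂W)`, with the complex tangencies `ξ_J` pushed forward by `e₁` and by `e₂` equal on the
seam — i.e. the seam self-gluing `ĉ = e₂⁻¹ ∘ e₁|∂W` is a contactomorphism of `(∂W, ξ_J)`. Conclusion: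
`M ≅ S⁴`. (ℚ-acyclicity is automatic for contractible `W`.)
Why plausibly true / what it contains: `ĉ` extending over `W` gives the doubles `D(W) = ∂(W × I)`, i.e. ALL
presentation spheres `Σ(P, ε)` (Disproof §4b; standard for Andrews–Curtis-trivial `P` and for the
Akbulut–Kirby family, Gompf 1991) — here fed only presentations whose relators are EMBEDDED curves on one
page (the card's T4 remark: innermost-curve / subsurface induction is available); `ĉ` not extending is a
Stein-compatible cork twist of `D(W)` (Gompf arXiv:1603.05090 Q2.2; symmetric-link cork twists of doubles are
`S⁴`, ideator evidence E2); by MFR `ĉ` may moreover be taken in `Aut(S, φ)` of the PALF open book (finite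
census for pseudo-Anosov `φ`). PROVED BELOW from the route's rank-4 crux
(`contractibleTwinTwistedDouble_of_crux4`), so this sector is already staffed. Size XL / open-problem at
`ĉ = id`. SPC4-implied (Disproof `shielded_of_spc4`), hence refutable only by an exotic `S⁴`. -/
theorem stub_contractibleTwinTwistedDouble
    (M : Type) [TopologicalSpace M] [T2Space M] [SecondCountableTopology M] [ChartedSpace E4 M]
    [IsManifold (𝓡 4) ∞ M] (hM : M ≃ₕ 𝕊⁴)
    (W : Type) [TopologicalSpace W] [ChartedSpace (EuclideanHalfSpace 4) W] [IsManifold (𝓡∂ 4) ∞ W]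
    [CompactSpace W] [ContractibleSpace W] (J : SteinStructure W) (e₁ e₂ : W → M)
    (he₁ : Manifold.IsSmoothEmbedding (𝓡∂ 4) (𝓡 4) ∞ e₁)
    (he₂ : Manifold.IsSmoothEmbedding (𝓡∂ 4) (𝓡 4) ∞ e₂)
    (hcover : range e₁ ∪ range e₂ = univ)
    (hseam₁ : range e₁ ∩ range e₂ = e₁ '' (𝓡∂ 4).boundary W)
    (hseam₂ : range e₁ ∩ range e₂ = e₂ '' (𝓡∂ 4).boundary W)
    (hξ : ∀ w w', e₁ w = e₂ w' →
      Submodule.map (mfderiv (𝓡∂ 4) (𝓡 4) e₁ w).toLinearMap (contactPlane J.J w) =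
      Submodule.map (mfderiv (𝓡∂ 4) (𝓡 4) e₂ w').toLinearMap (contactPlane J.J w')) :
    Nonempty (M ≃ₘ⟮𝓡 4, 𝓡 4⟯ 𝕊⁴) := by
  sorry

/-! ## Stub 3 — residual, torsion / perfect-π₁ sector -/

/-- **Stub 3 (RESIDUAL, NON-CONTRACTIBLE SECTOR): a homotopy 4-sphere that is a contact twisted double
`W ∪_ĉ W̄` of ONE ℚ-acyclic, NON-contractible Stein domain is `S⁴`.** Same data as Stub 2 with
`ContractibleSpace W` replaced by `¬ ContractibleSpace W` plus ℚ-acyclicity of `W` in positive degrees (for a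
Stein 2-handlebody these say exactly `b₁ = b₂ = 0 ≠ π₁ W`; `H₁ W` finite, `|H₁ W|² = |H₁ ∂W|`, or `π₁ W`
perfect). Here `ĉ` NEVER extends over `W` (`π₁ D(W) = π₁ W ≠ 1 = π₁ M`), so this is the sector of genuinely
twisted doubles: the INHABITED standard instance `S⁴ = X_L ∪_ψ X̄_L` (`X_L = N₋₂(ℝP²)` Gompf 1998 Ex. 4.14,
seam `S³/Q₈ = M(−1; ½,½,½)` with `ξ₁`, `ψ` the `ξ₁`-preserving transposition of exceptional fibres moving
`ker(H₁∂ → H₁X_L)`; Ghiggini–Lisca–Stipsicz arXiv:math/0509714 §4; Disproof §5b / `f2sq_mayer_vietoris`),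
standard by Price 1977 / Kim–Miller arXiv:1805.00429 §3.1. Why plausibly true: spherical seams are confined to
the prism family `±D(p,q)` (Choe–Park arXiv:1803.08749 Thm 1.1 + `zmod_sq_not_prod`), lens sums are Stein on
neither side (Etnyre–Tosun 2022 Thm 8), and by MFR `ĉ` is an open-book symmetry of a minimal PALF — a finite
census per `(S, φ)` followed by Price/Gluck-type recognisers; no exotic candidate is believed to live here
(Disproof §7 (T4): a second ℚ-acyclic filling of `(S³/Q₈, ξ₁)` would be the first test sphere). Size L.
SPC4-implied, hence refutable only by an exotic `S⁴`. -/
theorem stub_nonContractibleTwinTwistedDouble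
    (M : Type) [TopologicalSpace M] [T2Space M] [SecondCountableTopology M] [ChartedSpace E4 M]
    [IsManifold (𝓡 4) ∞ M] (hM : M ≃ₕ 𝕊⁴)
    (W : Type) [TopologicalSpace W] [ChartedSpace (EuclideanHalfSpace 4) W] [IsManifold (𝓡∂ 4) ∞ W]
    [CompactSpace W] (hW : ¬ ContractibleSpace W) (J : SteinStructure W) (e₁ e₂ : W → M)
    (he₁ : Manifold.IsSmoothEmbedding (𝓡∂ 4) (𝓡 4) ∞ e₁)
    (he₂ : Manifold.IsSmoothEmbedding (𝓡∂ 4) (𝓡 4) ∞ e₂)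
    (hcover : range e₁ ∪ range e₂ = univ)
    (hseam₁ : range e₁ ∩ range e₂ = e₁ '' (𝓡∂ 4).boundary W)
    (hseam₂ : range e₁ ∩ range e₂ = e₂ '' (𝓡∂ 4).boundary W)
    (hξ : ∀ w w', e₁ w = e₂ w' →
      Submodule.map (mfderiv (𝓡∂ 4) (𝓡 4) e₁ w).toLinearMap (contactPlane J.J w) =
      Submodule.map (mfderiv (𝓡∂ 4) (𝓡 4) e₂ w').toLinearMap (contactPlane J.J w'))
    (hac : ∀ k, 0 < k → IsZero (singularHomology ℚ ℚ W k)) :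
    Nonempty (M ≃ₘ⟮𝓡 4, 𝓡 4⟯ 𝕊⁴) := by
  sorry

/-! ## The composition (kernel-checked, no `sorry` of its own) -/

/-- **Re-parametrising a half: seam planes.** If `Φ : W₁ ≅ W₂` is a boundary contactomorphism
(`DΦ ξ₁ = ξ₂` on `∂W₁`) and the planes pushed forward by `e₁` and `e₂` agree on the seam, then so do the
planes pushed forward by `e₁` and `e₂ ∘ Φ`, both read with `J₁` (chain rule). [folklore] -/
theorem seamPlanes_comp_diffeomorph
    {M : Type} [TopologicalSpace M] [ChartedSpace E4 M]
    {W₁ : Type} [TopologicalSpace W₁] [ChartedSpace (EuclideanHalfSpace 4) W₁] [IsManifold (𝓡∂ 4) ∞ W₁]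
    {W₂ : Type} [TopologicalSpace W₂] [ChartedSpace (EuclideanHalfSpace 4) W₂] [IsManifold (𝓡∂ 4) ∞ W₂]
    (ξ₁ : W₁ → Submodule ℝ E4) (ξ₂ : W₂ → Submodule ℝ E4) {e₁ : W₁ → M} {e₂ : W₂ → M}
    (he₂ : Manifold.IsSmoothEmbedding (𝓡∂ 4) (𝓡 4) ∞ e₂)
    (hseam₂ : range e₁ ∩ range e₂ = e₂ '' (𝓡∂ 4).boundary W₂)
    (hξ : ∀ w₁ w₂, e₁ w₁ = e₂ w₂ →
      Submodule.map (mfderiv (𝓡∂ 4) (𝓡 4) e₁ w₁).toLinearMap (ξ₁ w₁) =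
      Submodule.map (mfderiv (𝓡∂ 4) (𝓡 4) e₂ w₂).toLinearMap (ξ₂ w₂))
    (Φ : W₁ ≃ₘ⟮𝓡∂ 4, 𝓡∂ 4⟯ W₂)
    (hΦ : ∀ w, w ∈ (𝓡∂ 4).boundary W₁ →
      Submodule.map (mfderiv (𝓡∂ 4) (𝓡∂ 4) Φ w).toLinearMap (ξ₁ w) = ξ₂ (Φ w)) :
    ∀ w w', e₁ w = (e₂ ∘ Φ) w' →
      Submodule.map (mfderiv (𝓡∂ 4) (𝓡 4) e₁ w).toLinearMap (ξ₁ w) =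
      Submodule.map (mfderiv (𝓡∂ 4) (𝓡 4) (e₂ ∘ Φ) w').toLinearMap (ξ₁ w') := by
  intro w w' h
  have hn : (∞ : WithTop ℕ∞) ≠ 0 := by simp
  -- the matched point `Φ w'` is a boundary point of `W₂`, hence `w'` one of `W₁`
  have hmem : e₂ (Φ w') ∈ range e₁ ∩ range e₂ := ⟨⟨w, h⟩, ⟨Φ w', rfl⟩⟩
  rw [hseam₂] at hmem
  obtain ⟨v, hv, hve⟩ := hmem
  have hv' : v = Φ w' := he₂.isEmbedding.injective hve
  have hb₂ : Φ w' ∈ (𝓡∂ 4).boundary W₂ := hv' ▸ hv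
  have hb₁ : w' ∈ (𝓡∂ 4).boundary W₁ := by
    have : w' ∈ Φ ⁻¹' (𝓡∂ 4).boundary W₂ := hb₂
    rwa [Φ.preimage_boundary hn] at this
  -- chain rule
  have hd₂ : MDifferentiableAt (𝓡∂ 4) (𝓡 4) e₂ (Φ w') :=
    he₂.contMDiff.mdifferentiableAt (by simp)
  have hdΦ : MDifferentiableAt (𝓡∂ 4) (𝓡∂ 4) Φ w' := Φ.mdifferentiable (by simp) w'
  have hcomp : mfderiv (𝓡∂ 4) (𝓡 4) (e₂ ∘ Φ) w' =
      (mfderiv (𝓡∂ 4) (𝓡 4) e₂ (Φ w')).comp (mfderiv (𝓡∂ 4) (𝓡∂ 4) Φ w') :=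
    mfderiv_comp w' hd₂ hdΦ
  have key : Submodule.map (mfderiv (𝓡∂ 4) (𝓡 4) (e₂ ∘ Φ) w').toLinearMap (ξ₁ w') =
      Submodule.map (mfderiv (𝓡∂ 4) (𝓡 4) e₂ (Φ w')).toLinearMap
        (Submodule.map (mfderiv (𝓡∂ 4) (𝓡∂ 4) Φ w').toLinearMap (ξ₁ w')) := by
    rw [← Submodule.map_comp]
    congr 1
    rw [hcomp]
    rfl
  rw [key, hΦ w' hb₁]
  exact hξ w (Φ w') h

/-- **The composition: the three stubs prove the crux `ConvexBisection.AcyclicBisectionRigidity` BY NAME.**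
Given the crux data, Stub 1 yields contact twins `Φ : W₁ ≅ W₂`; the second half is re-parametrised by
`e₂ ∘ Φ : W₁ → M` (a smooth embedding by the tree lemma `Manifold.IsSmoothEmbedding.comp_diffeomorph`;
same image; boundary to seam by `Diffeomorph.image_boundary`; seam planes by `seamPlanes_comp_diffeomorph`),
so `M` is a contact twisted double of `(W₁, J₁)`; Stub 2 (if `W₁` is contractible) or Stub 3 (if not; `W₁`
is ℚ-acyclic by hypothesis) gives `M ≅ S⁴`. -/
theorem AcyclicBisectionRigidity_of : ConvexBisection.AcyclicBisectionRigidity := by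
  intro M _ _ _ _ _ hM hb
  obtain ⟨W₁, _, _, _, _, W₂, _, _, _, _, J₁, J₂, e₁, e₂, he₁, he₂, hcover, hseam₁, hseam₂, hξ, hac⟩ := hb
  obtain ⟨Φ, hΦ⟩ := stub_minimalFactorisationTwins M hM W₁ W₂ J₁ J₂ e₁ e₂ he₁ he₂ hcover hseam₁ hseam₂
    hξ hac
  have hn : (∞ : WithTop ℕ∞) ≠ 0 := by simp
  -- the re-parametrised second half
  have he₂' : Manifold.IsSmoothEmbedding (𝓡∂ 4) (𝓡 4) ∞ (e₂ ∘ Φ) := he₂.comp_diffeomorph Φ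
  have hsurj : Function.Surjective (Φ : W₁ → W₂) := fun y => ⟨Φ.symm y, Φ.apply_symm_apply y⟩
  have hrange : range (e₂ ∘ Φ) = range e₂ := by
    rw [range_comp, hsurj.range_eq, image_univ]
  have hcover' : range e₁ ∪ range (e₂ ∘ Φ) = univ := by rw [hrange]; exact hcover
  have hseam₁' : range e₁ ∩ range (e₂ ∘ Φ) = e₁ '' (𝓡∂ 4).boundary W₁ := by rw [hrange]; exact hseam₁
  have hseam₂' : range e₁ ∩ range (e₂ ∘ Φ) = (e₂ ∘ Φ) '' (𝓡∂ 4).boundary W₁ := by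
    rw [hrange, image_comp, Φ.image_boundary hn]; exact hseam₂
  have hξ' := seamPlanes_comp_diffeomorph (fun w => contactPlane J₁.J w) (fun w => contactPlane J₂.J w)
    he₂ hseam₂ hξ Φ hΦ
  have hac₁ : ∀ k, 0 < k → IsZero (singularHomology ℚ ℚ W₁ k) := fun k hk => (hac k hk).1
  by_cases hW : ContractibleSpace W₁
  · exact stub_contractibleTwinTwistedDouble M hM W₁ J₁ e₁ (e₂ ∘ Φ) he₁ he₂' hcover' hseam₁' hseam₂' hξ'
  · exact stub_nonContractibleTwinTwistedDouble M hM W₁ hW J₁ e₁ (e₂ ∘ Φ) he₁ he₂' hcover' hseam₁'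
      hseam₂' hξ' hac₁

/-! ## Cross-links (sorry-free): the contractible sector is crux 4; the falsifiable shadow of Stub 1 -/

/-- **Stub 2 is implied by the route's rank-4 crux `ContractibleTwistedDoubleStandard`** (take
`X = M`, compact by the PROVED tree fact `compactSpace_of_homotopyEquiv_sphere_four_holds`, and
`W₁ = W₂ = W`, `J₁ = J₂ = J`): the contractible sector of this line is already staffed as crux 4, and a
Stein-compatible exotic cork re-gluing kills crux 2, crux 4 and this line at once (Disproof §4). -/
theorem contractibleTwinTwistedDouble_of_crux4 (h4 : ConvexBisection.ContractibleTwistedDoubleStandard)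
    (M : Type) [TopologicalSpace M] [T2Space M] [SecondCountableTopology M] [ChartedSpace E4 M]
    [IsManifold (𝓡 4) ∞ M] (hM : M ≃ₕ 𝕊⁴)
    (W : Type) [TopologicalSpace W] [ChartedSpace (EuclideanHalfSpace 4) W] [IsManifold (𝓡∂ 4) ∞ W]
    [CompactSpace W] [ContractibleSpace W] (J : SteinStructure W) (e₁ e₂ : W → M)
    (he₁ : Manifold.IsSmoothEmbedding (𝓡∂ 4) (𝓡 4) ∞ e₁)
    (he₂ : Manifold.IsSmoothEmbedding (𝓡∂ 4) (𝓡 4) ∞ e₂)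
    (hcover : range e₁ ∪ range e₂ = univ)
    (hseam₁ : range e₁ ∩ range e₂ = e₁ '' (𝓡∂ 4).boundary W)
    (hseam₂ : range e₁ ∩ range e₂ = e₂ '' (𝓡∂ 4).boundary W)
    (hξ : ∀ w w', e₁ w = e₂ w' →
      Submodule.map (mfderiv (𝓡∂ 4) (𝓡 4) e₁ w).toLinearMap (contactPlane J.J w) =
      Submodule.map (mfderiv (𝓡∂ 4) (𝓡 4) e₂ w').toLinearMap (contactPlane J.J w')) :
    Nonempty (M ≃ₘ⟮𝓡 4, 𝓡 4⟯ 𝕊⁴) := by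
  haveI : CompactSpace M :=
    Literature.Topology.FourManifolds.compactSpace_of_homotopyEquiv_sphere_four_holds M hM
  exact h4 M W W J J e₁ e₂ he₁ he₂ hcover hseam₁ hseam₂ hξ

/-- **The card's First lemma `AcyclicTwinsDiffeomorphic` is a corollary of Stub 1** (forget the contact
condition): the two halves of an acyclic common-contact Stein bisection of a homotopy 4-sphere are
diffeomorphic. NOT implied by SPC4, hence refutable WITHOUT an exotic sphere — the line's cheapest
falsifier (Disproof §6: Akbulut–Yildiz arXiv:1901.00806 Thm 1, Hayden–Mark–Piccirillo arXiv:1908.05269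
§6.0.1, one contact-class comparison away). -/
theorem acyclicTwinsDiffeomorphic_of_stub
    (M : Type) [TopologicalSpace M] [T2Space M] [SecondCountableTopology M] [ChartedSpace E4 M]
    [IsManifold (𝓡 4) ∞ M] (hM : M ≃ₕ 𝕊⁴)
    (W₁ : Type) [TopologicalSpace W₁] [ChartedSpace (EuclideanHalfSpace 4) W₁] [IsManifold (𝓡∂ 4) ∞ W₁]
    [CompactSpace W₁] (W₂ : Type) [TopologicalSpace W₂] [ChartedSpace (EuclideanHalfSpace 4) W₂]
    [IsManifold (𝓡∂ 4) ∞ W₂] [CompactSpace W₂] (J₁ : SteinStructure W₁) (J₂ : SteinStructure W₂)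
    (e₁ : W₁ → M) (e₂ : W₂ → M)
    (he₁ : Manifold.IsSmoothEmbedding (𝓡∂ 4) (𝓡 4) ∞ e₁)
    (he₂ : Manifold.IsSmoothEmbedding (𝓡∂ 4) (𝓡 4) ∞ e₂)
    (hcover : range e₁ ∪ range e₂ = univ)
    (hseam₁ : range e₁ ∩ range e₂ = e₁ '' (𝓡∂ 4).boundary W₁)
    (hseam₂ : range e₁ ∩ range e₂ = e₂ '' (𝓡∂ 4).boundary W₂)
    (hξ : ∀ w₁ w₂, e₁ w₁ = e₂ w₂ →
      Submodule.map (mfderiv (𝓡∂ 4) (𝓡 4) e₁ w₁).toLinearMap (contactPlane J₁.J w₁) =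
      Submodule.map (mfderiv (𝓡∂ 4) (𝓡 4) e₂ w₂).toLinearMap (contactPlane J₂.J w₂))
    (hac : ∀ k, 0 < k → IsZero (singularHomology ℚ ℚ W₁ k) ∧ IsZero (singularHomology ℚ ℚ W₂ k)) :
    Nonempty (W₁ ≃ₘ⟮𝓡∂ 4, 𝓡∂ 4⟯ W₂) :=
  let ⟨Φ, _⟩ := stub_minimalFactorisationTwins M hM W₁ W₂ J₁ J₂ e₁ e₂ he₁ he₂ hcover hseam₁ hseam₂ hξ hac
  ⟨Φ⟩

end Summit.SmoothPoincare4.SmoothPoincare4.Cruxes.AcyclicBisectionRigidity.MinimalFactorisationRigidity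

end
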